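import Literature.NumberTheory.LFunctions.SelbergFujiiLargeGaps
import Literature.NumberTheory.LFunctions.ZeroGapsProofs
import Literature.NumberTheory.LFunctions.TuringMethod
import HarnessLib

/-!
# Selberg–Fujii from Fujii's moment estimates (Titchmarsh §9.26, first step) — proofs

Trunk T-ANT (`Literature/NumberTheory/LFunctions`). Proofs only (no definitions, no named facts).
Third file of the Selberg–Fujii cluster: `ZeroGaps.lean` records the named facts
`Literature.NumberTheory.LFunctions.selberg_fujii_large_gaps` / `…small_gaps` (Titchmarsh
(9.25.5)–(9.25.6)); `ZeroGapsProofs.lean` proves small gaps from large gaps (last paragraph of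
§9.26); `SelbergFujiiLargeGaps.lean` proves large gaps from the first-moment bound (9.26.1) and
the gap second moment (9.25.4)₂. This file supplies the remaining step of Heath-Brown's sketch:
(9.26.1) from Fujii's moment estimates (9.25.2)–(9.25.3) for `S(t + h) − S(t)`, where
`S(T) = Literature.NumberTheory.LFunctions.zetaArgS T := N(T) − θ(T)/π − 1` (`RiemannSiegel.lean`).

## Main results

* `Literature.NumberTheory.LFunctions.SelbergFujii.first_moment_of_moments` — PROVED: if
  (9.25.2) `∫_0^T |S(t+h) − S(t)|² dt = π⁻² T log(3 + h log T) + O(T (log(3 + h log T))^{1/2})`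
  and (9.25.3)₂ `∫_0^T |S(t+h) − S(t)|⁴ dt ≤ T (A log(3 + h log T))²`, uniformly in
  `0 ≤ h ≤ T/2` for `T ≥ T₀`, then for some `c > 0` and all large `T`,
  `∫_T^{2T} |N(t + 2πλ/log T) − N(t) − λ| dt ≥ c T` uniformly in `1 ≤ λ ≤ 2` ((9.26.1)).
* `Literature.NumberTheory.LFunctions.selberg_fujii_large_gaps_of_moments`,
  `Literature.NumberTheory.LFunctions.selberg_fujii_small_gaps_of_moments` — the two named facts
  of `ZeroGaps.lean` from the three published inputs (9.25.2), (9.25.3)₂, (9.25.4)₂ taken as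
  hypotheses in their printed form. The inputs themselves (Fujii 1975, resting on Selberg's
  1946 theory of `S(t)`) are NOT proved in the tree.

## The proof of `first_moment_of_moments` (Titchmarsh §9.26 with explicit constants)

With `u = h log T ∈ [2πM, 4πM]`:
* (`exists_nat_window`) `M ∈ ℕ` is chosen so that `log(3+u)/π² − 3|A|(log(4+u))^{1/2} ≥ 1` on
  that range; then (9.25.2) at `2T` and at `T` give `∫_T^{2T} |ΔS|² ≥ T`, and (9.25.3)₂ at `2T`
  gives `∫_T^{2T} |ΔS|⁴ ≤ c₄ T` (`ΔS = S(t+h) − S(t)`; interval integrability from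
  `exists_abs_zetaArgS_sub_le`, `measurable_zetaArgS`).
* (`sq_div_sub_pow_four_div_le_abs`) instead of Hölder's inequality the pointwise
  `|x| ≥ x²/K − x⁴/K³` with `K = 2c₄` is integrated: `∫_T^{2T} |ΔS| ≥ 3T/(8c₄)`.
* (`abs_theta_sub_sub_le`, `abs_zetaArgS_sub_le`) `θ(t+h) − θ(t) = (h/2) log T + O(h)` on
  `[T, 2T]` (from `|θ'(u) − ½ log(u/2π)| ≤ 2/u`, `RiemannSiegelThetaBounds.lean`), so
  `|N(t+h) − N(t) − h log T/2π| ≥ |ΔS| − h` and `∫_T^{2T} |N(t+h) − N(t) − h log T/2π| ≥ T/(4c₄)`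
  once `h ≤ 1/(8c₄)`.
* Telescoping `h = Mℓ`, `ℓ = 2πλ/log T`: `N(t+h) − N(t) − Mλ = Σ_{m<M} δ(t + mℓ)`,
  `δ(s) = N(s+ℓ) − N(s) − λ`, and each shifted window is moved back to `[T, 2T]` at cost
  `∫_{2T}^{2T+Mℓ} |δ| ≤ Mℓ (N(2T+1) − N(2T) + 2) ≤ E₁` (`exists_zetaZeroCount_add_one_sub_le`:
  `N(t+1) − N(t) ≤ K₁ log t`, Riemann–von Mangoldt). Hence `∫_T^{2T} |δ| ≥ T/(16 c₄ M)` for large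
  `T`.

## References

* E. C. Titchmarsh, *The Theory of the Riemann Zeta-Function*, 2nd ed. revised by
  D. R. Heath-Brown (1986), §9.25 (9.25.2)–(9.25.6), §9.26, Thm. 9.4, §4.17. [key `Titchmarsh1986`]
* A. Fujii, *On the distribution of the zeros of the Riemann zeta function in short intervals*,
  Bull. Amer. Math. Soc. 81 (1975), 139–142 (Titchmarsh's Fujii [1]: (9.25.2)–(9.25.3));
  *On the difference between r consecutive ordinates of the zeros of the Riemann zeta function*,
  Proc. Japan Acad. 51 (1975), 741–743 (Titchmarsh's Fujii [2]: (9.25.4)–(9.25.6)).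
* A. Selberg, *Contributions to the theory of the Riemann zeta-function*, Arch. Math. Naturvid.
  48 (1946), no. 5, 89–155.
-/

noncomputable section

open Real MeasureTheory Set Filter Asymptotics

namespace Literature.NumberTheory.LFunctions

namespace SelbergFujii

/-! ### More consequences of the Riemann–von Mangoldt formula -/

/-- `N(t + 1) − N(t) ≤ K₁ log t` for all large `t` (Riemann–von Mangoldt; Titchmarsh Thm. 9.2 is
the sharper `O(log t)` statement proved directly). [cite: Titchmarsh1986, Thm. 9.4] -/
theorem exists_zetaZeroCount_add_one_sub_le :
    ∃ K₁ : ℝ, 0 < K₁ ∧ ∃ T₀ : ℝ, 1 ≤ T₀ ∧ ∀ t : ℝ, T₀ ≤ t →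
      (zetaZeroCount (t + 1) : ℝ) - zetaZeroCount t ≤ K₁ * Real.log t := by
  obtain ⟨K₀, hK₀, T₀, hT₀, h⟩ := exists_abs_zetaZeroCount_sub_le
  have hπ : 3 < π := Real.pi_gt_three
  refine ⟨2 + 3 * K₀, by positivity, max T₀ (Real.exp 1), (hT₀.trans (le_max_left _ _)),
    fun t ht ↦ ?_⟩
  have ht₀ : T₀ ≤ t := (le_max_left _ _).trans ht
  have ht1 : 1 ≤ t := hT₀.trans ht₀
  have hlogt : 1 ≤ Real.log t := by
    rw [← Real.log_exp 1]; exact Real.log_le_log (Real.exp_pos 1) ((le_max_right _ _).trans ht)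
  have h1 := (abs_le.1 (h (t + 1) (by linarith))).2
  have h2 := (abs_le.1 (h t ht₀)).1
  have hlog2 : Real.log 2 < 1 := by have := Real.log_two_lt_d9; linarith
  have hlogt1 : Real.log (t + 1) ≤ Real.log 2 + Real.log t := by
    rw [← Real.log_mul (by norm_num) (by positivity)]
    exact Real.log_le_log (by positivity) (by linarith)
  -- `log((t+1)/2π) ≤ log(t/2π) + 1/t`
  have hq : Real.log ((t + 1) / (2 * π)) ≤ Real.log (t / (2 * π)) + 1 / t := by
    have : Real.log ((t + 1) / (2 * π)) = Real.log (t / (2 * π)) + Real.log ((t + 1) / t) := by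
      rw [← Real.log_mul (by positivity) (by positivity)]
      congr 1; field_simp
    rw [this]
    have := Real.log_le_sub_one_of_pos (show 0 < (t + 1) / t by positivity)
    have e : (t + 1) / t - 1 = 1 / t := by field_simp; ring
    linarith
  have hmul : (t + 1) / (2 * π) * Real.log ((t + 1) / (2 * π)) ≤
      (t + 1) / (2 * π) * (Real.log (t / (2 * π)) + 1 / t) :=
    mul_le_mul_of_nonneg_left hq (by positivity)
  have hsplit : Real.log (t / (2 * π)) = Real.log t - Real.log (2 * π) :=
    Real.log_div (by positivity) (by positivity)
  have hlog2π : 0 ≤ Real.log (2 * π) := Real.log_nonneg (by linarith)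
  have ht0 : t ≠ 0 := by positivity
  have hπ0 : π ≠ 0 := Real.pi_ne_zero
  have e1 : (t + 1) / (2 * π) * (Real.log (t / (2 * π)) + 1 / t) -
      t / (2 * π) * Real.log (t / (2 * π)) =
      (Real.log t - Real.log (2 * π)) / (2 * π) + (t + 1) / (2 * π * t) := by
    rw [hsplit]; field_simp; ring
  have e0 : -((t + 1) / (2 * π)) + t / (2 * π) = -(1 / (2 * π)) := by ring
  have hπinv : 0 < 1 / (2 * π) := by positivity
  have hlogt0 : 0 ≤ Real.log t := by linarith
  have e2 : (Real.log t - Real.log (2 * π)) / (2 * π) ≤ Real.log t / 6 := by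
    rw [div_le_div_iff₀ (by positivity) (by norm_num)]
    nlinarith [mul_nonneg (by linarith : (0 : ℝ) ≤ 2 * π - 6) hlogt0]
  have e3 : (t + 1) / (2 * π * t) ≤ 1 := by
    rw [div_le_one (by positivity)]
    nlinarith [mul_le_mul_of_nonneg_right hπ.le (by linarith : (0 : ℝ) ≤ t)]
  have e4 : K₀ * Real.log (t + 1) ≤ K₀ * (1 + Real.log t) :=
    mul_le_mul_of_nonneg_left (by linarith) hK₀.le
  have e5 : 0 ≤ K₀ * (Real.log t - 1) := mul_nonneg hK₀.le (by linarith)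
  linarith

/-! ### The increment of `θ` over a short interval -/

/-- `log(2π) < 2`. [folklore] -/
theorem log_two_pi_lt_two : Real.log (2 * π) < 2 := by
  have hπ := Real.pi_lt_d2
  have he := Real.exp_one_gt_d9
  rw [Real.log_lt_iff_lt_exp (by positivity)]
  have : Real.exp 2 = Real.exp 1 * Real.exp 1 := by rw [← Real.exp_add]; norm_num
  nlinarith

/-- For `1 ≤ T ≤ t ≤ 2T` and `0 ≤ h ≤ 1`: `|θ(t + h) − θ(t) − (h/2) log T| ≤ 3h`, from
`|θ'(u) − ½ log(u/2π)| ≤ 2/u` (`abs_riemannSiegelThetaDeriv_sub_log_le`) and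
`|log(u/(2πT))| ≤ log 2π < 2` for `u ∈ [T, 2T + 1]`. [cite: Titchmarsh1986, §4.17 and §9.26] -/
theorem abs_theta_sub_sub_le {T t h : ℝ} (hT : 1 ≤ T) (ht : T ≤ t) (ht2 : t ≤ 2 * T)
    (hh : 0 ≤ h) (hh1 : h ≤ 1) :
    |riemannSiegelTheta (t + h) - riemannSiegelTheta t - h / 2 * Real.log T| ≤ 3 * h := by
  have hπ : 3 < π := Real.pi_gt_three
  have hcont := continuous_riemannSiegelThetaDeriv_holds
  have hint : ∀ a b : ℝ, IntervalIntegrable riemannSiegelThetaDeriv volume a b := fun a b ↦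
    hcont.intervalIntegrable a b
  have hsub : riemannSiegelTheta (t + h) - riemannSiegelTheta t - h / 2 * Real.log T =
      ∫ u in t..t + h, (riemannSiegelThetaDeriv u - Real.log T / 2) := by
    simp only [riemannSiegelTheta]
    rw [intervalIntegral.integral_sub (hint _ _) intervalIntegrable_const,
      intervalIntegral.integral_interval_sub_left (hint 0 (t + h)) (hint 0 t),
      intervalIntegral.integral_const, smul_eq_mul]
    ring
  rw [hsub]
  have hbound : ∀ u ∈ Set.uIoc t (t + h), ‖riemannSiegelThetaDeriv u - Real.log T / 2‖ ≤ 3 := by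
    intro u hu
    rw [uIoc_of_le (by linarith)] at hu
    have hu1 : 1 ≤ u := by linarith [hu.1]
    have h1 := abs_riemannSiegelThetaDeriv_sub_log_le hu1
    have h2u : 2 / u ≤ 2 := by rw [div_le_iff₀ (by linarith)]; linarith
    -- `log(u/2π) − log T = log(u/(2πT)) ∈ [−log 2π, 0]`
    have hq : Real.log (u / (2 * π)) - Real.log T = Real.log (u / (2 * π * T)) := by
      rw [← Real.log_div (by positivity) (by positivity)]
      congr 1; field_simp
    have hq1 : Real.log (u / (2 * π * T)) ≤ 0 := by
      apply Real.log_nonpos (by positivity)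
      rw [div_le_one (by positivity)]; nlinarith [hu.2]
    have hTu : T ≤ u := by linarith [hu.1]
    have hq2 : -Real.log (2 * π) ≤ Real.log (u / (2 * π * T)) := by
      rw [← Real.log_inv]
      apply Real.log_le_log (by positivity)
      rw [inv_eq_one_div, div_le_div_iff₀ (by positivity) (by positivity)]
      nlinarith [Real.pi_pos]
    have hl2π := log_two_pi_lt_two
    rw [Real.norm_eq_abs]
    have := abs_add_le (riemannSiegelThetaDeriv u - Real.log (u / (2 * π)) / 2)
      ((Real.log (u / (2 * π)) - Real.log T) / 2)
    have e : riemannSiegelThetaDeriv u - Real.log (u / (2 * π)) / 2 +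
        (Real.log (u / (2 * π)) - Real.log T) / 2 = riemannSiegelThetaDeriv u - Real.log T / 2 := by
      ring
    rw [e] at this
    have h3 : |(Real.log (u / (2 * π)) - Real.log T) / 2| ≤ 1 := by
      rw [hq, abs_le]; constructor <;> linarith
    linarith
  have := intervalIntegral.norm_integral_le_of_norm_le_const hbound
  rwa [Real.norm_eq_abs, add_sub_cancel_left, abs_of_nonneg hh] at this

/-- `S(t + h) − S(t) = (N(t + h) − N(t)) − (θ(t + h) − θ(t))/π` (the definition
`S = N − θ/π − 1`). [folklore] -/
theorem zetaArgS_sub (t h : ℝ) : zetaArgS (t + h) - zetaArgS t =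
    ((zetaZeroCount (t + h) : ℝ) - zetaZeroCount t) -
      (riemannSiegelTheta (t + h) - riemannSiegelTheta t) / π := by
  simp only [zetaArgS]; ring

/-- On `[T, 2T]` (`T ≥ 1`, `0 ≤ h ≤ 1`): `|N(t+h) − N(t) − h log T/(2π)| ≥ |S(t+h) − S(t)| − h`.
[cite: Titchmarsh1986, §9.26] -/
theorem abs_zetaArgS_sub_le {T t h : ℝ} (hT : 1 ≤ T) (ht : T ≤ t) (ht2 : t ≤ 2 * T)
    (hh : 0 ≤ h) (hh1 : h ≤ 1) :
    |zetaArgS (t + h) - zetaArgS t| - h ≤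
      |(zetaZeroCount (t + h) : ℝ) - zetaZeroCount t - h * Real.log T / (2 * π)| := by
  have hπ : 3 < π := Real.pi_gt_three
  have hθ := abs_theta_sub_sub_le hT ht ht2 hh hh1
  rw [zetaArgS_sub]
  have e : ((zetaZeroCount (t + h) : ℝ) - zetaZeroCount t) -
      (riemannSiegelTheta (t + h) - riemannSiegelTheta t) / π =
      ((zetaZeroCount (t + h) : ℝ) - zetaZeroCount t - h * Real.log T / (2 * π)) -
        (riemannSiegelTheta (t + h) - riemannSiegelTheta t - h / 2 * Real.log T) / π := by
    field_simp; ring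
  rw [e]
  have h2 : |(riemannSiegelTheta (t + h) - riemannSiegelTheta t - h / 2 * Real.log T) / π| ≤
      h := by
    rw [abs_div, abs_of_pos Real.pi_pos, div_le_iff₀ Real.pi_pos]
    nlinarith
  linarith [abs_sub ((zetaZeroCount (t + h) : ℝ) - zetaZeroCount t - h * Real.log T / (2 * π))
    ((riemannSiegelTheta (t + h) - riemannSiegelTheta t - h / 2 * Real.log T) / π)]

/-! ### Real-variable tools -/

/-- `x²/K − x⁴/K³ ≤ |x|` for `K > 0` (split at `|x| = K`): the first absolute moment is
controlled from below by the second and fourth moments without Hölder's inequality.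
[folklore] -/
theorem sq_div_sub_pow_four_div_le_abs (x : ℝ) {K : ℝ} (hK : 0 < K) :
    x ^ 2 / K - x ^ 4 / K ^ 3 ≤ |x| := by
  have ha : 0 ≤ |x| := abs_nonneg x
  have e2 : x ^ 2 = |x| ^ 2 := (sq_abs x).symm
  have e4 : x ^ 4 = |x| ^ 4 := by
    rw [show (4 : ℕ) = 2 * 2 from rfl, pow_mul, pow_mul, e2]
  rw [e2, e4, div_sub_div _ _ hK.ne' (by positivity), div_le_iff₀ (by positivity)]
  rcases le_or_gt |x| K with h | h
  · have h1 : |x| * |x| * K ^ 3 ≤ |x| * K * K ^ 3 :=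
      mul_le_mul_of_nonneg_right (mul_le_mul_of_nonneg_left h ha) (pow_pos hK 3).le
    nlinarith [mul_nonneg hK.le (pow_nonneg ha 4)]
  · have h1 : K ^ 2 ≤ |x| ^ 2 := pow_le_pow_left₀ hK.le h.le 2
    have h2 : 0 ≤ |x| ^ 2 * K * (|x| ^ 2 - K ^ 2) :=
      mul_nonneg (mul_nonneg (sq_nonneg _) hK.le) (sub_nonneg.2 h1)
    nlinarith [mul_nonneg ha (pow_nonneg hK.le 4)]

/-- Choice of the constant `M` of §9.26: for `M` large, `log(3 + u)/π² − 3|A| √(log(4 + u)) ≥ 1`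
throughout `2πM ≤ u ≤ 4πM`. [cite: Titchmarsh1986, §9.26] -/
theorem exists_nat_window (A : ℝ) : ∃ M : ℕ, 1 ≤ M ∧ ∀ u : ℝ, 2 * π * M ≤ u → u ≤ 4 * π * M →
    1 ≤ Real.log (3 + u) / π ^ 2 - 3 * |A| * Real.sqrt (Real.log (4 + u)) := by
  have hπ : 3 < π := Real.pi_gt_three
  set B : ℝ := 12 * (|A| + 1) * π ^ 2 with hB
  have hBpos : 0 < B := by positivity
  set Y : ℝ := max (2 * π ^ 2) (B ^ 2 / 2) with hY
  refine ⟨⌈Real.exp Y⌉₊, Nat.succ_le_of_lt (Nat.lt_ceil.2 (by exact_mod_cast Real.exp_pos Y)),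
    fun u hu1 _ ↦ ?_⟩
  have hM : Real.exp Y ≤ (⌈Real.exp Y⌉₊ : ℝ) := Nat.le_ceil _
  have hM0 : (0 : ℝ) ≤ ⌈Real.exp Y⌉₊ := Nat.cast_nonneg _
  have hu0 : 0 ≤ u := le_trans (by positivity) hu1
  set y := Real.log (3 + u) with hy
  have hyY : Y ≤ y := by
    rw [hy, ← Real.log_exp Y]
    apply Real.log_le_log (Real.exp_pos Y)
    nlinarith [Real.exp_pos Y, mul_nonneg (by linarith : (0 : ℝ) ≤ 2 * π - 1) hM0]
  have hy1 : 2 * π ^ 2 ≤ y := (le_max_left _ _).trans hyY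
  have hy2 : B ^ 2 / 2 ≤ y := (le_max_right _ _).trans hyY
  have hypos : 0 < y := by nlinarith [pow_pos Real.pi_pos 2]
  -- `log(4 + u) ≤ 2 log(3 + u)` since `4 + u ≤ (3 + u)²`
  have hz : Real.log (4 + u) ≤ 2 * y := by
    rw [hy, ← Real.log_rpow (by linarith), Real.rpow_two]
    exact Real.log_le_log (by linarith) (by nlinarith)
  -- `√(2y) ≤ 2y/B` since `B² ≤ 2y`
  have hsqrt : Real.sqrt (Real.log (4 + u)) ≤ 2 * y / B := by
    refine (Real.sqrt_le_sqrt hz).trans ?_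
    rw [Real.sqrt_le_left (by positivity), div_pow, le_div_iff₀ (by positivity)]
    nlinarith [mul_le_mul_of_nonneg_left (by linarith : B ^ 2 ≤ 2 * y) (by linarith : (0 : ℝ) ≤ 2 * y)]
  have h3 : 3 * |A| * Real.sqrt (Real.log (4 + u)) ≤ 3 * (|A| + 1) * (2 * y / B) :=
    mul_le_mul (by linarith) hsqrt (Real.sqrt_nonneg _) (by positivity)
  have hA1 : |A| + 1 ≠ 0 := by positivity
  have hπ2 : π ^ 2 ≠ 0 := by positivity
  have e : 3 * (|A| + 1) * (2 * y / B) = y / (2 * π ^ 2) := by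
    rw [hB]; field_simp; ring
  rw [e] at h3
  have : y / π ^ 2 - y / (2 * π ^ 2) = y / (2 * π ^ 2) := by ring
  have h4 : 1 ≤ y / (2 * π ^ 2) := by rw [le_div_iff₀ (by positivity)]; linarith
  linarith

/-! ### Measurability and boundedness of `S(t + h) − S(t)` -/

/-- `S` is measurable (`N` is monotone, `θ` continuous — `continuous_riemannSiegelTheta`,
`TuringMethod.lean`). [folklore] -/
theorem measurable_zetaArgS : Measurable zetaArgS := by
  have h : zetaArgS = fun T ↦ (zetaZeroCount T : ℝ) - riemannSiegelTheta T / π - 1 := rfl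
  rw [h]
  exact (monotone_zetaZeroCount_real.measurable.sub
    (continuous_riemannSiegelTheta.measurable.div_const π)).sub measurable_const

/-- A measurable real function bounded on `[a, b]` is interval integrable there. [folklore] -/
theorem intervalIntegrable_of_abs_le {f : ℝ → ℝ} {a b C : ℝ} (hab : a ≤ b) (hf : Measurable f)
    (hC : ∀ t ∈ Icc a b, |f t| ≤ C) : IntervalIntegrable f volume a b := by
  rw [intervalIntegrable_iff_integrableOn_Icc_of_le hab]
  refine Measure.integrableOn_of_bounded (M := C) measure_Icc_lt_top.ne hf.aestronglyMeasurable ?_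
  exact (ae_restrict_iff' measurableSet_Icc).2 (Eventually.of_forall fun t ht ↦ by
    rw [Real.norm_eq_abs]; exact hC t ht)

/-- `S(t + h) − S(t)` is bounded on every compact interval (`0 ≤ N(t+h) − N(t) ≤ N(b + 1)` and
`θ` is continuous). [folklore] -/
theorem exists_abs_zetaArgS_sub_le (a b : ℝ) {h : ℝ} (hh : 0 ≤ h) (hh1 : h ≤ 1) :
    ∃ C : ℝ, 0 ≤ C ∧ ∀ t ∈ Icc a b, |zetaArgS (t + h) - zetaArgS t| ≤ C := by
  obtain ⟨Cθ, hCθ⟩ := (isCompact_Icc (a := a) (b := b + 1)).exists_bound_of_continuousOn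
    continuous_riemannSiegelTheta.continuousOn
  have hπ : 3 < π := Real.pi_gt_three
  refine ⟨zetaZeroCount (b + 1) + 2 * |Cθ|, by positivity, fun t ht ↦ ?_⟩
  rw [zetaArgS_sub]
  have hmN := monotone_zetaZeroCount_real
  have h1 : (zetaZeroCount t : ℝ) ≤ zetaZeroCount (t + h) := hmN (by linarith)
  have h2 : (zetaZeroCount (t + h) : ℝ) ≤ zetaZeroCount (b + 1) := hmN (by linarith [ht.2])
  have h0 : (0 : ℝ) ≤ zetaZeroCount t := Nat.cast_nonneg _
  have h3 := hCθ (t + h) ⟨by linarith [ht.1], by linarith [ht.2]⟩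
  have h4 := hCθ t ⟨ht.1, by linarith [ht.2]⟩
  rw [Real.norm_eq_abs] at h3 h4
  have h5 : |(riemannSiegelTheta (t + h) - riemannSiegelTheta t) / π| ≤ 2 * |Cθ| := by
    rw [abs_div, abs_of_pos Real.pi_pos, div_le_iff₀ Real.pi_pos]
    have := abs_sub (riemannSiegelTheta (t + h)) (riemannSiegelTheta t)
    nlinarith [le_abs_self Cθ, abs_nonneg Cθ, mul_nonneg (abs_nonneg Cθ) (by linarith : (0 : ℝ) ≤ π - 1)]
  have := abs_sub ((zetaZeroCount (t + h) : ℝ) - zetaZeroCount t)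
    ((riemannSiegelTheta (t + h) - riemannSiegelTheta t) / π)
  rw [abs_of_nonneg (by linarith : (0 : ℝ) ≤ (zetaZeroCount (t + h) : ℝ) - zetaZeroCount t)]
    at this
  linarith

/-! ### The window `[T, 2T]`: second and fourth moments of `S(t + h) − S(t)` -/

/-- Powers of `S(t + h) − S(t)` are interval integrable on `[0, 2T]` (bounded and measurable).
[folklore] -/
theorem intervalIntegrable_zetaArgS_sub_pow {T h : ℝ} (hT : 0 ≤ T) (hh : 0 ≤ h) (hh1 : h ≤ 1)
    (n : ℕ) : IntervalIntegrable (fun t ↦ (zetaArgS (t + h) - zetaArgS t) ^ n) volume 0 (2 * T) := by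
  have hFm : Measurable fun t ↦ zetaArgS (t + h) - zetaArgS t :=
    (measurable_zetaArgS.comp (measurable_id.add_const h)).sub measurable_zetaArgS
  obtain ⟨CF, -, hCF⟩ := exists_abs_zetaArgS_sub_le 0 (2 * T) hh hh1
  exact intervalIntegrable_of_abs_le (by positivity) (hFm.pow_const n) (C := CF ^ n)
    fun t ht ↦ by rw [abs_pow]; exact pow_le_pow_left₀ (abs_nonneg _) (hCF t ht) n

/-- Step A of §9.26, second moment: (9.25.2) at `2T` and at `T`, in the window
`log(3+u)/π² − 3|A| √log(4+u) ≥ 1` (`u = h log T`), give `∫_T^{2T} |S(t+h) − S(t)|² dt ≥ T`.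
[cite: Titchmarsh1986, §9.26] -/
theorem le_integral_zetaArgS_sub_sq {T h A : ℝ} (hT : 1 ≤ T) (hh : 0 ≤ h) (hh1 : h ≤ 1)
    (hA : |(∫ t in (0 : ℝ)..2 * T, (zetaArgS (t + h) - zetaArgS t) ^ 2) -
        2 * T * Real.log (3 + h * Real.log (2 * T)) / π ^ 2| ≤
      A * (2 * T * Real.sqrt (Real.log (3 + h * Real.log (2 * T)))))
    (hB : |(∫ t in (0 : ℝ)..T, (zetaArgS (t + h) - zetaArgS t) ^ 2) -
        T * Real.log (3 + h * Real.log T) / π ^ 2| ≤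
      A * (T * Real.sqrt (Real.log (3 + h * Real.log T))))
    (hwin : 1 ≤ Real.log (3 + h * Real.log T) / π ^ 2 -
      3 * |A| * Real.sqrt (Real.log (4 + h * Real.log T))) :
    T ≤ ∫ t in T..2 * T, (zetaArgS (t + h) - zetaArgS t) ^ 2 := by
  have hiF := intervalIntegrable_zetaArgS_sub_pow (by linarith : (0 : ℝ) ≤ T) hh hh1 2
  have hsub1 : uIcc T (2 * T) ⊆ uIcc 0 (2 * T) := by
    rw [uIcc_of_le (by linarith : T ≤ 2 * T), uIcc_of_le (by linarith : (0 : ℝ) ≤ 2 * T)]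
    exact Icc_subset_Icc (by linarith) le_rfl
  have hsub0 : uIcc 0 T ⊆ uIcc 0 (2 * T) := by
    rw [uIcc_of_le (by linarith : (0 : ℝ) ≤ T), uIcc_of_le (by linarith : (0 : ℝ) ≤ 2 * T)]
    exact Icc_subset_Icc le_rfl (by linarith)
  have hsplit := intervalIntegral.integral_add_adjacent_intervals (hiF.mono_set hsub0)
    (hiF.mono_set hsub1)
  have hA' := (abs_le.1 hA).1
  have hB' := (abs_le.1 hB).2
  have hlogT : 0 ≤ Real.log T := Real.log_nonneg hT
  have hu0 : 0 ≤ h * Real.log T := mul_nonneg hh hlogT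
  have hln2 : Real.log 2 < 1 := by have := Real.log_two_lt_d9; linarith
  have hln2' : 0 ≤ Real.log 2 := Real.log_nonneg (by norm_num)
  have hl2T : h * Real.log (2 * T) = h * Real.log T + h * Real.log 2 := by
    rw [Real.log_mul (by norm_num : (2 : ℝ) ≠ 0) (by positivity : T ≠ 0)]; ring
  have hlog2' : 0 ≤ h * Real.log 2 := mul_nonneg hh hln2'
  have hlog2'' : h * Real.log 2 ≤ 1 := (mul_le_of_le_one_right hh hln2.le).trans hh1
  have hm1 : Real.log (3 + h * Real.log T) ≤ Real.log (3 + h * Real.log (2 * T)) :=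
    Real.log_le_log (by linarith) (by linarith)
  have hm2 : Real.sqrt (Real.log (3 + h * Real.log (2 * T))) ≤
      Real.sqrt (Real.log (4 + h * Real.log T)) :=
    Real.sqrt_le_sqrt (Real.log_le_log (by linarith) (by linarith))
  have hm3 : Real.sqrt (Real.log (3 + h * Real.log T)) ≤
      Real.sqrt (Real.log (4 + h * Real.log T)) :=
    Real.sqrt_le_sqrt (Real.log_le_log (by linarith) (by linarith))
  have p1 : 2 * T * Real.log (3 + h * Real.log T) / π ^ 2 ≤
      2 * T * Real.log (3 + h * Real.log (2 * T)) / π ^ 2 :=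
    div_le_div_of_nonneg_right (mul_le_mul_of_nonneg_left hm1 (by positivity)) (by positivity)
  have p2 : A * (2 * T * Real.sqrt (Real.log (3 + h * Real.log (2 * T)))) ≤
      |A| * (2 * T * Real.sqrt (Real.log (4 + h * Real.log T))) :=
    (le_abs_self _).trans (by
      rw [abs_mul, abs_of_nonneg
        (by positivity : (0 : ℝ) ≤ 2 * T * Real.sqrt (Real.log (3 + h * Real.log (2 * T))))]
      exact mul_le_mul_of_nonneg_left (mul_le_mul_of_nonneg_left hm2 (by positivity))
        (abs_nonneg _))
  have p3 : A * (T * Real.sqrt (Real.log (3 + h * Real.log T))) ≤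
      |A| * (T * Real.sqrt (Real.log (4 + h * Real.log T))) :=
    (le_abs_self _).trans (by
      rw [abs_mul, abs_of_nonneg
        (by positivity : (0 : ℝ) ≤ T * Real.sqrt (Real.log (3 + h * Real.log T)))]
      exact mul_le_mul_of_nonneg_left (mul_le_mul_of_nonneg_left hm3 (by positivity))
        (abs_nonneg _))
  have p4 : T * 1 ≤ T * (Real.log (3 + h * Real.log T) / π ^ 2 -
      3 * |A| * Real.sqrt (Real.log (4 + h * Real.log T))) :=
    mul_le_mul_of_nonneg_left hwin (by positivity)
  calc T = T * 1 := (mul_one T).symm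
    _ ≤ T * (Real.log (3 + h * Real.log T) / π ^ 2 -
        3 * |A| * Real.sqrt (Real.log (4 + h * Real.log T))) := p4
    _ = 2 * T * Real.log (3 + h * Real.log T) / π ^ 2 - T * Real.log (3 + h * Real.log T) / π ^ 2 -
        |A| * (2 * T * Real.sqrt (Real.log (4 + h * Real.log T))) -
        |A| * (T * Real.sqrt (Real.log (4 + h * Real.log T))) := by ring
    _ ≤ 2 * T * Real.log (3 + h * Real.log (2 * T)) / π ^ 2 -
        T * Real.log (3 + h * Real.log T) / π ^ 2 -
        A * (2 * T * Real.sqrt (Real.log (3 + h * Real.log (2 * T)))) -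
        A * (T * Real.sqrt (Real.log (3 + h * Real.log T))) := by linarith only [p1, p2, p3]
    _ ≤ (∫ t in (0 : ℝ)..2 * T, (zetaArgS (t + h) - zetaArgS t) ^ 2) -
        ∫ t in (0 : ℝ)..T, (zetaArgS (t + h) - zetaArgS t) ^ 2 := by linarith only [hA', hB']
    _ = ∫ t in T..2 * T, (zetaArgS (t + h) - zetaArgS t) ^ 2 := by linarith only [hsplit]

/-- Step A of §9.26, fourth moment: (9.25.3) with `k = 2` at `2T` gives
`∫_T^{2T} |S(t+h) − S(t)|⁴ dt ≤ 2T (A log(4 + h log T))²`. [cite: Titchmarsh1986, §9.26] -/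
theorem integral_zetaArgS_sub_pow_four_le {T h A : ℝ} (hT : 1 ≤ T) (hh : 0 ≤ h) (hh1 : h ≤ 1)
    (hA : ∫ t in (0 : ℝ)..2 * T, (zetaArgS (t + h) - zetaArgS t) ^ 4 ≤
      2 * T * (A * Real.log (3 + h * Real.log (2 * T))) ^ 2) :
    ∫ t in T..2 * T, (zetaArgS (t + h) - zetaArgS t) ^ 4 ≤
      2 * T * (A * Real.log (4 + h * Real.log T)) ^ 2 := by
  have hiF := intervalIntegrable_zetaArgS_sub_pow (by linarith : (0 : ℝ) ≤ T) hh hh1 4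
  have hmono : ∫ t in T..2 * T, (zetaArgS (t + h) - zetaArgS t) ^ 4 ≤
      ∫ t in (0 : ℝ)..2 * T, (zetaArgS (t + h) - zetaArgS t) ^ 4 :=
    intervalIntegral.integral_mono_interval (by linarith) (by linarith) le_rfl
      (Eventually.of_forall fun t ↦ by positivity) hiF
  have hln2 : Real.log 2 < 1 := by have := Real.log_two_lt_d9; linarith
  have hlog2Tnn : 0 ≤ Real.log (2 * T) := Real.log_nonneg (by linarith)
  have hhl : 0 ≤ h * Real.log (2 * T) := mul_nonneg hh hlog2Tnn
  have hl : Real.log (3 + h * Real.log (2 * T)) ≤ Real.log (4 + h * Real.log T) := by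
    apply Real.log_le_log (by linarith)
    rw [Real.log_mul (by norm_num : (2 : ℝ) ≠ 0) (by positivity : T ≠ 0), mul_add]
    have : h * Real.log 2 ≤ 1 := (mul_le_of_le_one_right hh hln2.le).trans hh1
    linarith
  have hl0 : 0 ≤ Real.log (3 + h * Real.log (2 * T)) := Real.log_nonneg (by linarith)
  have h5 : (A * Real.log (3 + h * Real.log (2 * T))) ^ 2 ≤
      (A * Real.log (4 + h * Real.log T)) ^ 2 := by
    rw [mul_pow, mul_pow]
    exact mul_le_mul_of_nonneg_left (pow_le_pow_left₀ hl0 hl 2) (sq_nonneg _)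
  have h6 := mul_le_mul_of_nonneg_left h5 (by positivity : (0 : ℝ) ≤ 2 * T)
  linarith

/-- Steps B–C of §9.26: from `∫_T^{2T} |ΔS|² ≥ T`, `∫_T^{2T} |ΔS|⁴ ≤ c₄ T` and `h ≤ 1/(8c₄)`,
`∫_T^{2T} |N(t+h) − N(t) − h log T/(2π)| dt ≥ T/(4c₄)` (`|x| ≥ x²/K − x⁴/K³` with `K = 2c₄`,
and `|ΔN − h log T/2π| ≥ |ΔS| − h`). [cite: Titchmarsh1986, §9.26] -/
theorem le_integral_abs_zetaZeroCount_sub {T h c₄ : ℝ} (hT : 1 ≤ T) (hh : 0 ≤ h) (hh1 : h ≤ 1)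
    (hc₄ : 1 ≤ c₄) (hhc : h ≤ 1 / (8 * c₄))
    (hI2 : T ≤ ∫ t in T..2 * T, (zetaArgS (t + h) - zetaArgS t) ^ 2)
    (hI4 : ∫ t in T..2 * T, (zetaArgS (t + h) - zetaArgS t) ^ 4 ≤ c₄ * T) :
    T / (4 * c₄) ≤ ∫ t in T..2 * T,
      |(zetaZeroCount (t + h) : ℝ) - zetaZeroCount t - h * Real.log T / (2 * π)| := by
  have hmN := monotone_zetaZeroCount_real
  have hmNh : Monotone fun t : ℝ ↦ (zetaZeroCount (t + h) : ℝ) := fun a b hab ↦ hmN (by linarith)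
  have hiG : IntervalIntegrable
      (fun t ↦ (zetaZeroCount (t + h) : ℝ) - zetaZeroCount t - h * Real.log T / (2 * π))
      volume T (2 * T) :=
    (hmNh.intervalIntegrable.sub hmN.intervalIntegrable).sub intervalIntegrable_const
  have hsub1 : uIcc T (2 * T) ⊆ uIcc 0 (2 * T) := by
    rw [uIcc_of_le (by linarith : T ≤ 2 * T), uIcc_of_le (by linarith : (0 : ℝ) ≤ 2 * T)]
    exact Icc_subset_Icc (by linarith) le_rfl
  have hiF := fun n ↦
    (intervalIntegrable_zetaArgS_sub_pow (by linarith : (0 : ℝ) ≤ T) hh hh1 n).mono_set hsub1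
  obtain ⟨K, hK⟩ : ∃ K : ℝ, K = 2 * c₄ := ⟨_, rfl⟩
  have hKpos : 0 < K := by rw [hK]; positivity
  have hc₄ne : c₄ ≠ 0 := by positivity
  have hpt : ∀ t ∈ Icc T (2 * T),
      (zetaArgS (t + h) - zetaArgS t) ^ 2 / K - (zetaArgS (t + h) - zetaArgS t) ^ 4 / K ^ 3 - h ≤
        |(zetaZeroCount (t + h) : ℝ) - zetaZeroCount t - h * Real.log T / (2 * π)| :=
    fun t ht ↦ by
      have h1 := sq_div_sub_pow_four_div_le_abs (zetaArgS (t + h) - zetaArgS t) hKpos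
      have h2 := abs_zetaArgS_sub_le hT ht.1 ht.2 hh hh1
      linarith
  have hi0 : IntervalIntegrable (fun t ↦ (zetaArgS (t + h) - zetaArgS t) ^ 2 / K -
      (zetaArgS (t + h) - zetaArgS t) ^ 4 / K ^ 3) volume T (2 * T) :=
    ((hiF 2).div_const K).sub ((hiF 4).div_const (K ^ 3))
  have hmono := intervalIntegral.integral_mono_on (by linarith) (hi0.sub intervalIntegrable_const)
    hiG.abs hpt
  rw [intervalIntegral.integral_sub hi0 intervalIntegrable_const,
    intervalIntegral.integral_sub ((hiF 2).div_const K) ((hiF 4).div_const (K ^ 3)),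
    intervalIntegral.integral_div, intervalIntegral.integral_div,
    intervalIntegral.integral_const, smul_eq_mul] at hmono
  have q1 : T / K ≤ (∫ t in T..2 * T, (zetaArgS (t + h) - zetaArgS t) ^ 2) / K :=
    div_le_div_of_nonneg_right hI2 hKpos.le
  have q2 : (∫ t in T..2 * T, (zetaArgS (t + h) - zetaArgS t) ^ 4) / K ^ 3 ≤ c₄ * T / K ^ 3 :=
    div_le_div_of_nonneg_right hI4 (by positivity)
  have q3 : (2 * T - T) * h ≤ T / (8 * c₄) := by
    rw [show 2 * T - T = T by ring]
    calc T * h ≤ T * (1 / (8 * c₄)) := mul_le_mul_of_nonneg_left hhc (by linarith)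
      _ = T / (8 * c₄) := by ring
  have e0 : T / K = T / (2 * c₄) := by rw [hK]
  have e1 : c₄ * T / K ^ 3 ≤ T / (8 * c₄) := by
    rw [hK, div_le_div_iff₀ (by positivity) (by positivity)]
    nlinarith only [mul_nonneg (mul_nonneg (sq_nonneg c₄) (by linarith : (0 : ℝ) ≤ T))
      (by linarith : (0 : ℝ) ≤ c₄ - 1)]
  have e2 : T / (2 * c₄) - T / (8 * c₄) - T / (8 * c₄) = T / (4 * c₄) := by
    field_simp; ring
  linarith only [hmono, q1, q2, q3, e0, e1, e2]

/-! ### The telescoping step -/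

/-- Step D of §9.26: with `h = Mℓ`, `N(t+h) − N(t) − Mλ = Σ_{m<M} δ(t + mℓ)` where
`δ(s) = N(s+ℓ) − N(s) − λ`, each shifted window `[T + mℓ, 2T + mℓ]` is contained in
`[T, 2T + Mℓ]`, and `|δ| ≤ N(2T+1) − N(2T) + 2` on `[2T, 2T + Mℓ]` (`(M+1)ℓ ≤ 1`, `0 ≤ λ ≤ 2`);
hence `∫_T^{2T} |N(t+Mℓ) − N(t) − Mλ| ≤ M ∫_T^{2T} |δ| + M · Mℓ (N(2T+1) − N(2T) + 2)`.
[cite: Titchmarsh1986, §9.26] -/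
theorem integral_abs_telescope_le {T ℓ l : ℝ} {M : ℕ} (hT : 0 ≤ T) (hℓ : 0 ≤ ℓ) (hl0 : 0 ≤ l)
    (hl2 : l ≤ 2) (hMℓ1 : (M + 1) * ℓ ≤ 1) :
    ∫ t in T..2 * T, |(zetaZeroCount (t + M * ℓ) : ℝ) - zetaZeroCount t - M * l| ≤
      M * (∫ s in T..2 * T, |(zetaZeroCount (s + ℓ) : ℝ) - zetaZeroCount s - l|) +
        M * (M * ℓ * ((zetaZeroCount (2 * T + 1) : ℝ) - zetaZeroCount (2 * T) + 2)) := by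
  have hmN := monotone_zetaZeroCount_real
  have hgi : ∀ c a b : ℝ, IntervalIntegrable
      (fun t ↦ |(zetaZeroCount (t + c + ℓ) : ℝ) - zetaZeroCount (t + c) - l|) volume a b :=
    fun c a b ↦ by
      have hm1 : Monotone fun t : ℝ ↦ (zetaZeroCount (t + c + ℓ) : ℝ) := fun x y hxy ↦
        hmN (by linarith)
      have hm2 : Monotone fun t : ℝ ↦ (zetaZeroCount (t + c) : ℝ) := fun x y hxy ↦ hmN (by linarith)
      exact ((hm1.intervalIntegrable.sub hm2.intervalIntegrable).sub intervalIntegrable_const).abs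
  have hgi0 : ∀ a b : ℝ, IntervalIntegrable
      (fun t ↦ |(zetaZeroCount (t + ℓ) : ℝ) - zetaZeroCount t - l|) volume a b := fun a b ↦ by
    have hm1 : Monotone fun t : ℝ ↦ (zetaZeroCount (t + ℓ) : ℝ) := fun x y hxy ↦ hmN (by linarith)
    exact ((hm1.intervalIntegrable.sub hmN.intervalIntegrable).sub intervalIntegrable_const).abs
  have hmM : Monotone fun t : ℝ ↦ (zetaZeroCount (t + M * ℓ) : ℝ) := fun x y hxy ↦ hmN (by linarith)
  have hiG : IntervalIntegrable
      (fun t ↦ (zetaZeroCount (t + M * ℓ) : ℝ) - zetaZeroCount t - M * l) volume T (2 * T) :=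
    (hmM.intervalIntegrable.sub hmN.intervalIntegrable).sub intervalIntegrable_const
  -- the telescoping identity
  have htel : ∀ t : ℝ, (zetaZeroCount (t + M * ℓ) : ℝ) - zetaZeroCount t - M * l =
      ∑ m ∈ Finset.range M,
        ((zetaZeroCount (t + m * ℓ + ℓ) : ℝ) - zetaZeroCount (t + m * ℓ) - l) := fun t ↦ by
    rw [Finset.sum_sub_distrib, Finset.sum_const, Finset.card_range, nsmul_eq_mul]
    have hts := Finset.sum_range_sub (fun m ↦ (zetaZeroCount (t + m * ℓ) : ℝ)) M
    simp only [Nat.cast_succ, add_mul, one_mul, ← add_assoc, Nat.cast_zero, zero_mul,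
      add_zero] at hts
    rw [hts]
  have hsumfun : (∑ m ∈ Finset.range M, fun t : ℝ ↦
      |(zetaZeroCount (t + m * ℓ + ℓ) : ℝ) - zetaZeroCount (t + m * ℓ) - l|) =
      fun t ↦ ∑ m ∈ Finset.range M,
        |(zetaZeroCount (t + m * ℓ + ℓ) : ℝ) - zetaZeroCount (t + m * ℓ) - l| := by
    ext t; simp only [Finset.sum_apply]
  have hisum : IntervalIntegrable (fun t ↦ ∑ m ∈ Finset.range M,
      |(zetaZeroCount (t + m * ℓ + ℓ) : ℝ) - zetaZeroCount (t + m * ℓ) - l|) volume T (2 * T) := by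
    rw [← hsumfun]
    exact IntervalIntegrable.sum _ fun m _ ↦ hgi _ _ _
  have hfs := intervalIntegral.integral_finsetSum (μ := volume) (a := T) (b := 2 * T)
    (s := Finset.range M) (f := fun (m : ℕ) (t : ℝ) ↦
      |(zetaZeroCount (t + m * ℓ + ℓ) : ℝ) - zetaZeroCount (t + m * ℓ) - l|) fun m _ ↦ hgi _ _ _
  have hint1 : ∫ t in T..2 * T, |(zetaZeroCount (t + M * ℓ) : ℝ) - zetaZeroCount t - M * l| ≤
      ∑ m ∈ Finset.range M, ∫ t in T..2 * T,
        |(zetaZeroCount (t + m * ℓ + ℓ) : ℝ) - zetaZeroCount (t + m * ℓ) - l| := by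
    refine (intervalIntegral.integral_mono_on (by linarith) hiG.abs hisum fun t _ ↦ ?_).trans
      hfs.le
    rw [htel t]
    exact Finset.abs_sum_le_sum_abs _ _
  -- the tail window `[2T, 2T + Mℓ]`
  have hMℓ0 : 0 ≤ (M : ℝ) * ℓ := by positivity
  have htail : ∫ s in (2 * T)..(2 * T + M * ℓ), |(zetaZeroCount (s + ℓ) : ℝ) - zetaZeroCount s - l| ≤
      M * ℓ * ((zetaZeroCount (2 * T + 1) : ℝ) - zetaZeroCount (2 * T) + 2) := by
    have hbd : ∀ s ∈ Icc (2 * T) (2 * T + M * ℓ),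
        |(zetaZeroCount (s + ℓ) : ℝ) - zetaZeroCount s - l| ≤
          (zetaZeroCount (2 * T + 1) : ℝ) - zetaZeroCount (2 * T) + 2 := by
      intro s hs
      have h0 : (zetaZeroCount s : ℝ) ≤ zetaZeroCount (s + ℓ) := hmN (by linarith)
      have h1 : (zetaZeroCount (s + ℓ) : ℝ) ≤ zetaZeroCount (2 * T + 1) :=
        hmN (by linarith [hs.2])
      have h2 : (zetaZeroCount (2 * T) : ℝ) ≤ zetaZeroCount s := hmN hs.1
      rw [abs_le]; constructor <;> linarith
    have := intervalIntegral.integral_mono_on (by linarith : 2 * T ≤ 2 * T + M * ℓ) (hgi0 _ _)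
      intervalIntegrable_const hbd
    rwa [intervalIntegral.integral_const, smul_eq_mul,
      show 2 * T + M * ℓ - 2 * T = M * ℓ by ring] at this
  -- each shifted window
  have hshift : ∀ m ∈ Finset.range M, ∫ t in T..2 * T,
      |(zetaZeroCount (t + m * ℓ + ℓ) : ℝ) - zetaZeroCount (t + m * ℓ) - l| ≤
      (∫ s in T..2 * T, |(zetaZeroCount (s + ℓ) : ℝ) - zetaZeroCount s - l|) +
        M * ℓ * ((zetaZeroCount (2 * T + 1) : ℝ) - zetaZeroCount (2 * T) + 2) := by
    intro m hm
    have hmM : (m : ℝ) ≤ M := by exact_mod_cast (Finset.mem_range.1 hm).le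
    have hm0 : (0 : ℝ) ≤ m * ℓ := by positivity
    have hmM' : (m : ℝ) * ℓ ≤ M * ℓ := mul_le_mul_of_nonneg_right hmM hℓ
    show (∫ t in T..2 * T, (fun s ↦ |(zetaZeroCount (s + ℓ) : ℝ) - zetaZeroCount s - l|)
      (t + m * ℓ)) ≤ _
    rw [intervalIntegral.integral_comp_add_right
      (fun s ↦ |(zetaZeroCount (s + ℓ) : ℝ) - zetaZeroCount s - l|) ((m : ℝ) * ℓ)]
    calc ∫ s in T + m * ℓ..2 * T + m * ℓ, |(zetaZeroCount (s + ℓ) : ℝ) - zetaZeroCount s - l|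
        ≤ ∫ s in T..2 * T + M * ℓ, |(zetaZeroCount (s + ℓ) : ℝ) - zetaZeroCount s - l| :=
          intervalIntegral.integral_mono_interval (by linarith) (by linarith) (by linarith)
            (Eventually.of_forall fun s ↦ abs_nonneg _) (hgi0 _ _)
      _ = (∫ s in T..2 * T, |(zetaZeroCount (s + ℓ) : ℝ) - zetaZeroCount s - l|) +
            ∫ s in (2 * T)..(2 * T + M * ℓ), |(zetaZeroCount (s + ℓ) : ℝ) - zetaZeroCount s - l| :=
          (intervalIntegral.integral_add_adjacent_intervals (hgi0 _ _) (hgi0 _ _)).symm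
      _ ≤ _ := by linarith [htail]
  refine hint1.trans ((Finset.sum_le_sum hshift).trans ?_)
  rw [Finset.sum_const, Finset.card_range, nsmul_eq_mul]
  linarith

/-! ### The first moment from Fujii's second and fourth moments -/

/-- **Titchmarsh §9.26, first step: (9.25.2) + (9.25.3) ⟹ (9.26.1).** From Fujii's mean
square asymptotic (9.25.2),
`∫_0^T |S(t+h) − S(t)|² dt = π⁻² T log(3 + h log T) + O(T √log(3 + h log T))`, and the case
`k = 2` of his moment bound (9.25.3), `∫_0^T |S(t+h) − S(t)|⁴ dt ≤ T (A log(3 + h log T))²`,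
both uniformly in `0 ≤ h ≤ T/2`, it follows that for some `c > 0` and all large `T`,
`∫_T^{2T} |N(t + 2πλ/log T) − N(t) − λ| dt ≥ c T` uniformly in `1 ≤ λ ≤ 2` — displayed as
(9.26.1) in the source and taken as hypothesis by `selberg_fujii_large_gaps_of_first_moment`.
(The source uses Hölder's inequality to get `∫_T^{2T} |S(t+h) − S(t)| dt ≫ T`; here the
pointwise inequality `|x| ≥ x²/K − x⁴/K³` is integrated instead. The passage from `S` to `N` is
`S = N − θ/π − 1` with `θ(t+h) − θ(t) = (h/2) log T + O(h)` on `[T, 2T]`, and the passage from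
`h = 2πMλ/log T` to `2πλ/log T` is the telescoping of §9.26.) The constant `A k⁴` of (9.25.3)
at `k = 2` is absorbed into `A`. [cite: Titchmarsh1986, §9.26 (9.26.1)] -/
theorem first_moment_of_moments
    (h252 : ∃ A : ℝ, ∃ T₀ : ℝ, ∀ T : ℝ, T₀ ≤ T → ∀ h : ℝ, 0 ≤ h → h ≤ T / 2 →
      |(∫ t in (0 : ℝ)..T, (zetaArgS (t + h) - zetaArgS t) ^ 2) -
          T * Real.log (3 + h * Real.log T) / π ^ 2| ≤
        A * (T * Real.sqrt (Real.log (3 + h * Real.log T))))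
    (h253 : ∃ A : ℝ, ∃ T₀ : ℝ, ∀ T : ℝ, T₀ ≤ T → ∀ h : ℝ, 0 ≤ h → h ≤ T / 2 →
      ∫ t in (0 : ℝ)..T, (zetaArgS (t + h) - zetaArgS t) ^ 4 ≤
        T * (A * Real.log (3 + h * Real.log T)) ^ 2) :
    ∃ c : ℝ, 0 < c ∧ ∃ T₁ : ℝ, ∀ T : ℝ, T₁ ≤ T → ∀ l : ℝ, 1 ≤ l → l ≤ 2 →
      c * T ≤ ∫ t in T..2 * T,
        |(zetaZeroCount (t + 2 * π * l / Real.log T) : ℝ) - zetaZeroCount t - l| := by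
  obtain ⟨A₂, T₂, h252⟩ := h252
  obtain ⟨A₄, T₄, h253⟩ := h253
  obtain ⟨M, hM1, hMwin⟩ := exists_nat_window A₂
  obtain ⟨K₁, hK₁, T₅, hT₅1, hK₁5⟩ := exists_zetaZeroCount_add_one_sub_le
  have hπ : 3 < π := Real.pi_gt_three
  have hM : (1 : ℝ) ≤ M := by exact_mod_cast hM1
  have hmN := monotone_zetaZeroCount_real
  -- constants
  obtain ⟨c₄, hc₄1, hc₄⟩ : ∃ c₄ : ℝ, 1 ≤ c₄ ∧ 2 * A₄ ^ 2 * Real.log (4 + 4 * π * M) ^ 2 ≤ c₄ :=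
    ⟨2 * A₄ ^ 2 * Real.log (4 + 4 * π * M) ^ 2 + 1,
      by nlinarith [sq_nonneg (A₄ * Real.log (4 + 4 * π * M))], by linarith⟩
  obtain ⟨E₁, hE₁⟩ : ∃ E₁ : ℝ, E₁ = 4 * π * M * (2 * K₁ + 1) := ⟨_, rfl⟩
  have hE₁pos : 0 < E₁ := by rw [hE₁]; positivity
  refine ⟨1 / (16 * c₄ * M), by positivity,
    max (max (max T₂ T₄) (max T₅ 2)) (max (Real.exp (4 * π * (M + 1)))
      (max (Real.exp (32 * π * M * c₄)) (8 * M * E₁ * c₄))), fun T hT l hl1 hl2 ↦ ?_⟩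
  simp only [max_le_iff] at hT
  obtain ⟨⟨⟨hT2, hT4⟩, hT5, hT2'⟩, hTe, hTc, hTE⟩ := hT
  have hT1 : 1 ≤ T := by linarith only [hT2']
  have hlogT : 4 * π * (M + 1) ≤ Real.log T := by
    rw [← Real.log_exp (4 * π * (M + 1))]; exact Real.log_le_log (Real.exp_pos _) hTe
  have h24 : (24 : ℝ) ≤ 4 * π * (M + 1) := by
    nlinarith only [hπ, hM, mul_nonneg (by linarith only [hπ] : (0 : ℝ) ≤ π - 3)
      (by linarith only [hM] : (0 : ℝ) ≤ M + 1)]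
  have hlogpos : 0 < Real.log T := by linarith only [hlogT, h24]
  have hlogne : Real.log T ≠ 0 := hlogpos.ne'
  have hlogc : 32 * π * M * c₄ ≤ Real.log T := by
    rw [← Real.log_exp (32 * π * M * c₄)]; exact Real.log_le_log (Real.exp_pos _) hTc
  have hln2 : Real.log 2 < 1 := by have := Real.log_two_lt_d9; linarith only [this]
  have hlog2T : Real.log (2 * T) ≤ 2 * Real.log T := by
    rw [Real.log_mul (by norm_num) (by positivity)]; linarith only [hln2, hlogT, h24]
  -- `ℓ = 2πl/log T`, `h = M ℓ`, `u = h log T = 2πMl ∈ [2πM, 4πM]`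
  set ℓ : ℝ := 2 * π * l / Real.log T with hℓ
  have hℓpos : 0 < ℓ := by positivity
  have hu : M * ℓ * Real.log T = 2 * π * M * l := by rw [hℓ]; field_simp
  have hπM : 0 ≤ 2 * π * M := by positivity
  have hu1 : 2 * π * M ≤ M * ℓ * Real.log T := by
    rw [hu]; linarith only [mul_le_mul_of_nonneg_left hl1 hπM]
  have hu2 : M * ℓ * Real.log T ≤ 4 * π * M := by
    rw [hu]; linarith only [mul_le_mul_of_nonneg_left hl2 hπM]
  have hMℓ1 : (M + 1) * ℓ ≤ 1 := by
    rw [hℓ, mul_div_assoc', div_le_one hlogpos]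
    have : (M + 1) * (2 * π * l) ≤ (M + 1) * (4 * π) :=
      mul_le_mul_of_nonneg_left (by nlinarith only [hl2, Real.pi_pos]) (by linarith only [hM])
    linarith only [this, hlogT]
  have hMℓ0 : 0 ≤ (M : ℝ) * ℓ := by positivity
  have hh1 : M * ℓ ≤ 1 := by linarith only [hMℓ1, hℓpos.le]
  have hhc : M * ℓ ≤ 1 / (8 * c₄) := by
    rw [le_div_iff₀ (by positivity)]
    have h8 : M * ℓ * (8 * c₄) * Real.log T ≤ 1 * Real.log T := by
      have e8 : M * ℓ * (8 * c₄) * Real.log T = 8 * c₄ * (M * ℓ * Real.log T) := by ring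
      rw [e8, one_mul]
      linarith only [mul_le_mul_of_nonneg_left hu2 (by positivity : (0 : ℝ) ≤ 8 * c₄), hlogc]
    exact le_of_mul_le_mul_right h8 hlogpos
  -- Step A
  have hwin : 1 ≤ Real.log (3 + M * ℓ * Real.log T) / π ^ 2 -
      3 * |A₂| * Real.sqrt (Real.log (4 + M * ℓ * Real.log T)) := hMwin _ hu1 hu2
  have hI2 := le_integral_zetaArgS_sub_sq hT1 hMℓ0 hh1
    (h252 (2 * T) (by linarith only [hT2, hT2']) (M * ℓ) hMℓ0 (by linarith only [hh1, hT2']))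
    (h252 T hT2 (M * ℓ) hMℓ0 (by linarith only [hh1, hT2'])) hwin
  have hI4' := integral_zetaArgS_sub_pow_four_le hT1 hMℓ0 hh1
    (h253 (2 * T) (by linarith only [hT4, hT2']) (M * ℓ) hMℓ0 (by linarith only [hh1, hT2']))
  have hI4 : ∫ t in T..2 * T, (zetaArgS (t + M * ℓ) - zetaArgS t) ^ 4 ≤ c₄ * T := by
    have hl : Real.log (4 + M * ℓ * Real.log T) ≤ Real.log (4 + 4 * π * M) :=
      Real.log_le_log (by linarith only [hu1, hπM]) (by linarith only [hu2])
    have hl0 : 0 ≤ Real.log (4 + M * ℓ * Real.log T) :=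
      Real.log_nonneg (by linarith only [hu1, hπM])
    have h5 : (A₄ * Real.log (4 + M * ℓ * Real.log T)) ^ 2 ≤
        A₄ ^ 2 * Real.log (4 + 4 * π * M) ^ 2 := by
      rw [mul_pow]
      exact mul_le_mul_of_nonneg_left (pow_le_pow_left₀ hl0 hl 2) (sq_nonneg _)
    have h6 := mul_le_mul_of_nonneg_left h5 (by positivity : (0 : ℝ) ≤ 2 * T)
    have h7 := mul_le_mul_of_nonneg_left hc₄ (by positivity : (0 : ℝ) ≤ T)
    linarith only [hI4', h6, h7]
  -- Steps B–C
  have hJ := le_integral_abs_zetaZeroCount_sub hT1 hMℓ0 hh1 hc₄1 hhc hI2 hI4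
  -- Step D
  have hD := integral_abs_telescope_le (M := M) (by linarith only [hT1] : (0 : ℝ) ≤ T) hℓpos.le
    (by linarith only [hl1] : (0 : ℝ) ≤ l) hl2 hMℓ1
  have e : M * ℓ * Real.log T / (2 * π) = M * l := by rw [hu]; field_simp
  rw [e] at hJ
  -- the tail constant
  have htail : (M : ℝ) * ℓ * ((zetaZeroCount (2 * T + 1) : ℝ) - zetaZeroCount (2 * T) + 2) ≤ E₁ := by
    have hK2T := hK₁5 (2 * T) (by linarith only [hT5, hT2'])
    have h4 : K₁ * Real.log (2 * T) ≤ K₁ * (2 * Real.log T) :=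
      mul_le_mul_of_nonneg_left hlog2T hK₁.le
    have h5 : (M : ℝ) * ℓ * ((zetaZeroCount (2 * T + 1) : ℝ) - zetaZeroCount (2 * T) + 2) ≤
        M * ℓ * (2 * K₁ * Real.log T + 2) :=
      mul_le_mul_of_nonneg_left (by linarith only [hK2T, h4]) hMℓ0
    have e2 : (M : ℝ) * ℓ * (2 * K₁ * Real.log T + 2) =
        2 * π * M * l * (2 * K₁ + 2 / Real.log T) := by
      rw [hℓ]; field_simp
    have h2 : 2 / Real.log T ≤ 1 := by rw [div_le_one hlogpos]; linarith only [hlogT, h24]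
    have h6 : 2 * π * M * l * (2 * K₁ + 2 / Real.log T) ≤ 2 * π * M * 2 * (2 * K₁ + 1) :=
      mul_le_mul (mul_le_mul_of_nonneg_left hl2 hπM) (by linarith only [h2]) (by positivity)
        (by positivity)
    rw [hE₁]; linarith only [h5, e2, h6]
  -- conclusion
  have hX : T / (4 * c₄) ≤ M * (∫ s in T..2 * T,
      |(zetaZeroCount (s + ℓ) : ℝ) - zetaZeroCount s - l|) + M * E₁ :=
    hJ.trans (hD.trans (by
      linarith only [mul_le_mul_of_nonneg_left htail (by linarith only [hM] : (0 : ℝ) ≤ M)]))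
  have hTE' : 8 * M * E₁ * c₄ ≤ T := hTE
  have hc₄pos : 0 < c₄ := by linarith only [hc₄1]
  have hc₄ne : c₄ ≠ 0 := hc₄pos.ne'
  rw [div_mul_eq_mul_div, one_mul, div_le_iff₀ (by positivity)]
  -- `M·X ≥ T/(4c₄) − M E₁ ≥ T/(8c₄)`, times `16 c₄`
  have h9 : M * E₁ ≤ T / (8 * c₄) := by
    rw [le_div_iff₀ (by positivity)]; linarith only [hTE']
  have h10 : T / (4 * c₄) - T / (8 * c₄) = T / (8 * c₄) := by field_simp; ring
  have h12 : T / (8 * c₄) ≤ M * ∫ s in T..2 * T,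
      |(zetaZeroCount (s + ℓ) : ℝ) - zetaZeroCount s - l| := by linarith only [hX, h9, h10]
  have h13 := mul_le_mul_of_nonneg_left h12 (by positivity : (0 : ℝ) ≤ 16 * c₄)
  have h14 : 16 * c₄ * (T / (8 * c₄)) = 2 * T := by field_simp; ring
  linarith only [h13, h14, hT1]

end SelbergFujii

open SelbergFujii in
/-- **Selberg–Fujii large gaps from Fujii's moment estimates (Titchmarsh §9.25–9.26).** The
named fact `Literature.NumberTheory.LFunctions.selberg_fujii_large_gaps` ((9.25.5) for a positive
proportion of `n`) follows from Fujii's (9.25.2), (9.25.3) (case `k = 2`) and (9.25.4)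
(case `k = 2`), taken as hypotheses in the printed form; the deduction (§9.26) is fully proved
(`first_moment_of_moments`, `selberg_fujii_large_gaps_of_first_moment`), the three inputs are
not. [cite: Titchmarsh1986, §9.25 (9.25.2)–(9.25.5) and §9.26] -/
theorem selberg_fujii_large_gaps_of_moments
    (h252 : ∃ A : ℝ, ∃ T₀ : ℝ, ∀ T : ℝ, T₀ ≤ T → ∀ h : ℝ, 0 ≤ h → h ≤ T / 2 →
      |(∫ t in (0 : ℝ)..T, (zetaArgS (t + h) - zetaArgS t) ^ 2) -
          T * Real.log (3 + h * Real.log T) / π ^ 2| ≤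
        A * (T * Real.sqrt (Real.log (3 + h * Real.log T))))
    (h253 : ∃ A : ℝ, ∃ T₀ : ℝ, ∀ T : ℝ, T₀ ≤ T → ∀ h : ℝ, 0 ≤ h → h ≤ T / 2 →
      ∫ t in (0 : ℝ)..T, (zetaArgS (t + h) - zetaArgS t) ^ 4 ≤
        T * (A * Real.log (3 + h * Real.log T)) ^ 2)
    (h254 : ∃ C : ℝ, ∃ T₂ : ℝ, ∀ T : ℝ, T₂ ≤ T →
      ∑ n ∈ Finset.range (zetaZeroCount T), (zetaOrdinate (n + 1) - zetaOrdinate n) ^ 2 ≤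
        C * (zetaZeroCount T : ℝ) / (Real.log T) ^ 2) :
    selberg_fujii_large_gaps :=
  selberg_fujii_large_gaps_of_first_moment (first_moment_of_moments h252 h253) h254

/-- **Selberg–Fujii small gaps from Fujii's moment estimates**: likewise for the named fact
`Literature.NumberTheory.LFunctions.selberg_fujii_small_gaps` ((9.25.6)), through
`selberg_fujii_small_gaps_of_large_gaps` (`ZeroGapsProofs.lean`, last paragraph of §9.26).
[cite: Titchmarsh1986, §9.25 (9.25.2)–(9.25.6) and §9.26] -/
theorem selberg_fujii_small_gaps_of_moments
    (h252 : ∃ A : ℝ, ∃ T₀ : ℝ, ∀ T : ℝ, T₀ ≤ T → ∀ h : ℝ, 0 ≤ h → h ≤ T / 2 →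
      |(∫ t in (0 : ℝ)..T, (zetaArgS (t + h) - zetaArgS t) ^ 2) -
          T * Real.log (3 + h * Real.log T) / π ^ 2| ≤
        A * (T * Real.sqrt (Real.log (3 + h * Real.log T))))
    (h253 : ∃ A : ℝ, ∃ T₀ : ℝ, ∀ T : ℝ, T₀ ≤ T → ∀ h : ℝ, 0 ≤ h → h ≤ T / 2 →
      ∫ t in (0 : ℝ)..T, (zetaArgS (t + h) - zetaArgS t) ^ 4 ≤
        T * (A * Real.log (3 + h * Real.log T)) ^ 2)
    (h254 : ∃ C : ℝ, ∃ T₂ : ℝ, ∀ T : ℝ, T₂ ≤ T →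
      ∑ n ∈ Finset.range (zetaZeroCount T), (zetaOrdinate (n + 1) - zetaOrdinate n) ^ 2 ≤
        C * (zetaZeroCount T : ℝ) / (Real.log T) ^ 2) :
    selberg_fujii_small_gaps :=
  selberg_fujii_small_gaps_of_large_gaps (selberg_fujii_large_gaps_of_moments h252 h253 h254)

end Literature.NumberTheory.LFunctions
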